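import Summits.BirchSwinnertonDyer.BirchSwinnertonDyer.Theorems.ThetaPartnerAtTwoSignedKatoUpToAtTwoFineStrictRat
import Mathlib.Algebra.Module.CharacterModule
import HarnessLib

/-!
# Route `ThetaPartnerAtTwo` (TP2), crux K3 `SignedKatoDivisibilityUpToAtTwo` (item stmt-BirchSwinnertonDyer-20308),
# line `colemanrat` v3 — THE CHARACTER MODEL OF THE POITOU–TATE MAP `j` AND ITS **EXACT** LOCAL COVER

Width seat `bsd-wall-tp2-p2x-w3` g2 (cell `bsd-wall`). HONEST FRAMING: THEOREMS ONLY — no definition, no named fact, no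
instance, no `sorry`; route-independent (no `Theses` import); closes no item; BSD is NOT proved by any of this.

## What this file does
The promoted package of K3 (`Cruxes/SignedKatoDivisibilityUpToAtTwo/W3G2_LocalPackageSketch.lean`, clause (PT)) asks, for
every pinned dual `D` of `Sel^ε(E/ℚ_∞)`, for a map `j : P → X^ε = D.X` out of a LOCAL module `P` with
* (LocCover) every `x ∈ X^ε` whose character `D.toDual x` kills `Sel^ε ∩ ker res_𝔭` satisfies `2^m • x ∈ range j`;
* (Rec) `2^m • j ∘ col = 0` on Kato's classes.

Here we take for `P` the model closest to Kobayashi's own (`X^ε ← (H¹(k_∞, E[p^∞]) / E^ε ⊗ ℚ_p/ℤ_p)^∨`, [Kobayashi2003, §1 proof of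
Thm. 1.2 and (8.23)]): the CHARACTER GROUP `P_H := Hom(H¹(H, E[p^∞]), ℚ/ℤ)` of the cohomology of ANY subgroup `H ≤ Γ_{K_∞} = ker κ`
(for K3: `H = ker κ ⊓ D_v`, `v ∣ 2`, i.e. `H¹(ℚ_{∞,𝔭}, E[2^∞])`), and `j := ` the transpose of `res_H : Sel^ε_∞ → H¹(H, E[p^∞])`
through the pinning `D.toDual : D.X ≅ Hom(Sel^ε_∞, ℚ/ℤ)`.  Then:

* §1 `exists_character_comp_eq_of_ker_le` — pure algebra: a character of `M` killing `ker g` factors through `g : M → N`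
  (`ℚ/ℤ` is divisible: Mathlib `CharacterModule.dual_surjective_of_injective`).
* §2 `exists_charModelJ` / `charModelJ_unique` — the transpose `j : P_H →+ D.X`, `D.toDual (j χ) s = χ (res_H s)`, unique.
* §3 `toDual_charModelJ_eq_zero_of_resOfLe_eq_zero`, `charModelJ_eq_zero_iff` — `range j` kills `Sel^ε ∩ ker res_H`;
  `ker j = ` the annihilator of `res_H(Sel^ε_∞)`.
* §4 **`mem_range_charModelJ_iff`** — (LocCover) holds EXACTLY (`m = 0`): `x ∈ range j ↔ D.toDual x` kills `Sel^ε ∩ ker res_H`.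
* §5 `toDual_X_smul_charModelJ`, `X_smul_charModelJ` (normal `H`), `toDual_C_smul_charModelJ` — the `Λ`-action through `j`
  in generator form (`T ↔ conj_γ − 1`, constants through `ℤ_p → ℤ/p^k`).
* §6 `exists_charModelJ_package_two` — `K = ℚ`, `p = 2`, `H = ker κ ⊓ D_v`: `j` with (value) ∧ (EXACT LocCover in the literal
  hypothesis shape of `signedKatoDivisibilityUpToAtTwo_of_localRobustZetaSpanPackageTwo_rat_of_pub`) ∧ (`T`-action).

So in the character model the (LocCover) clause of the package is a THEOREM with `m = 0`; what (PT) still asks is (Rec) alone,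
i.e. Poitou–Tate reciprocity for Kato's class against `Sel^ε` (`Cruxes/…/W3G2-RECIPROCITY-ROADMAP.md`).

References: [Kobayashi2003] Thm. 1.2 (proof, §1) and (8.23); [Greenberg1999] = GreenbergLNM1716 §1–2 (Selmer groups over `K_∞`
as `Λ`-modules via `conj`); Mathlib `Mathlib.Algebra.Module.CharacterModule`.
-/

set_option autoImplicit false
-- the Theorems namespace of this sub repeats the summit name by design (D-0017 nested layout)
set_option linter.dupNamespace false

noncomputable section

open scoped Classical

namespace Summit.BirchSwinnertonDyer.BirchSwinnertonDyer.Theorems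

namespace SignedKatoOffTwo.LocalChar

open NumberField IsDedekindDomain Field WeierstrassCurve
  Literature.NumberTheory.EllipticCurves Literature.NumberTheory.EllipticCurves.Kobayashi2003
  Literature.NumberTheory.EllipticCurves.GreenbergSelmer Literature.NumberTheory.GaloisRepresentations ZpExtension

universe u

/-! ## §1 Characters killing `ker g` factor through `g` -/

section Algebra

variable {M N : Type*} [AddCommGroup M] [AddCommGroup N]

/-- **A character killing `ker g` factors through `g`.** For `g : M → N` additive and `χ : M → ℚ/ℤ` with `χ(ker g) = 0` there is
`χ' : N → ℚ/ℤ` with `χ' ∘ g = χ`: `χ` descends to `M / ker g ≅ g(M)` and extends from `g(M) ≤ N` to `N` because `ℚ/ℤ` is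
divisible (Mathlib `CharacterModule.dual_surjective_of_injective`). Pontryagin-dually: `Ann(ker g) = g^∨(N^∨)`. [folklore] -/
theorem exists_character_comp_eq_of_ker_le (g : M →+ N) (χ : M →+ AddCircle (1 : ℚ))
    (hχ : ∀ m, g m = 0 → χ m = 0) : ∃ χ' : N →+ AddCircle (1 : ℚ), χ'.comp g = χ := by
  set G : M →ₗ[ℤ] N := g.toIntLinearMap with hG
  have hker : LinearMap.ker G ≤ LinearMap.ker χ.toIntLinearMap := fun m hm ↦ hχ m hm
  let ρ : LinearMap.range G →ₗ[ℤ] AddCircle (1 : ℚ) :=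
    ((LinearMap.ker G).liftQ χ.toIntLinearMap hker).comp (LinearMap.quotKerEquivRange G).symm.toLinearMap
  obtain ⟨χ', hχ'⟩ := CharacterModule.dual_surjective_of_injective (LinearMap.range G).subtype
    (Submodule.injective_subtype _) ρ.toAddMonoidHom
  refine ⟨χ', ?_⟩
  ext m
  have hm : G m ∈ LinearMap.range G := LinearMap.mem_range_self G m
  have h1 : χ' (G m) = ρ ⟨G m, hm⟩ := DFunLike.congr_fun hχ' ⟨G m, hm⟩
  rw [AddMonoidHom.comp_apply]
  change χ' (G m) = χ m
  rw [h1]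
  change ((LinearMap.ker G).liftQ χ.toIntLinearMap hker) ((LinearMap.quotKerEquivRange G).symm ⟨G m, hm⟩) = χ m
  rw [LinearMap.quotKerEquivRange_symm_apply_image]
  rfl

end Algebra

/-! ## §2 The transpose `j : Hom(H¹(H, E[p^∞]), ℚ/ℤ) → X^ε` of `res_H` -/

section CharModel

variable {K : Type u} [Field K] [NumberField K] (W : WeierstrassCurve K) (p : ℕ) [Fact p.Prime]
  (κ : ZpExtension K p) {γ : absoluteGaloisGroup K} (ε : ℤˣ) {H : Subgroup (absoluteGaloisGroup K)}
  (hle : H ≤ κ.kerSubgroup)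

/-- **The character-model Poitou–Tate map exists**: for a pinned dual `D` of `Sel^ε(E/K_∞)` and any `H ≤ Γ_{K_∞} = ker κ`
there is an additive `j : Hom(H¹(H, E[p^∞]), ℚ/ℤ) → X^ε` with `D.toDual (j χ) s = χ (res_H s)` on `Sel^ε_∞` — the transpose
of `res_H : Sel^ε_∞ → H¹(H, E[p^∞])` through `D.toDual : X^ε ≅ Hom(Sel^ε_∞, ℚ/ℤ)` (Kobayashi's
`X^ε ← (H¹(k_∞, E[p^∞]) / (E^ε ⊗ ℚ_p/ℤ_p))^∨`). [cite: Kobayashi2003, Thm. 1.2 (proof) and (8.23) (p. 18)]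
[cite: GreenbergLNM1716, §1–2] -/
theorem exists_charModelJ (D : SignedSelmerDualData W κ γ ε) :
    ∃ j : (W.subgroupH1 p H →+ AddCircle (1 : ℚ)) →+ D.X,
      ∀ (χ : W.subgroupH1 p H →+ AddCircle (1 : ℚ)) (s : W.subgroupH1 p κ.kerSubgroup)
        (hs : s ∈ signedSelmerInfty W κ ε), D.toDual (j χ) ⟨s, hs⟩ = χ (W.resOfLe p hle s) := by
  let e : D.X ≃+ (signedSelmerInfty W κ ε →+ AddCircle (1 : ℚ)) := AddEquiv.ofBijective D.toDual D.bijective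
  let r : signedSelmerInfty W κ ε →+ W.subgroupH1 p H := (W.resOfLe p hle).comp (signedSelmerInfty W κ ε).subtype
  let pre : (W.subgroupH1 p H →+ AddCircle (1 : ℚ)) →+ (signedSelmerInfty W κ ε →+ AddCircle (1 : ℚ)) :=
    { toFun := fun χ ↦ χ.comp r
      map_zero' := by ext; rfl
      map_add' := fun χ₁ χ₂ ↦ by ext; rfl }
  refine ⟨(e.symm : _ →+ D.X).comp pre, fun χ s hs ↦ ?_⟩
  have h1 : D.toDual (e.symm (pre χ)) = pre χ := AddEquiv.ofBijective_apply_symm_apply D.toDual D.bijective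
  have h2 : ((e.symm : _ →+ D.X).comp pre) χ = e.symm (pre χ) := rfl
  rw [h2, h1]
  rfl

/-- **Uniqueness of the character-model `j`**: the value formula pins `j` down (`D.toDual` is injective).
[cite: Kobayashi2003, Thm. 1.2 (proof) (p. 2)] -/
theorem charModelJ_unique (D : SignedSelmerDualData W κ γ ε) (j j' : (W.subgroupH1 p H →+ AddCircle (1 : ℚ)) →+ D.X)
    (hj : ∀ (χ : W.subgroupH1 p H →+ AddCircle (1 : ℚ)) (s : W.subgroupH1 p κ.kerSubgroup)
      (hs : s ∈ signedSelmerInfty W κ ε), D.toDual (j χ) ⟨s, hs⟩ = χ (W.resOfLe p hle s))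
    (hj' : ∀ (χ : W.subgroupH1 p H →+ AddCircle (1 : ℚ)) (s : W.subgroupH1 p κ.kerSubgroup)
      (hs : s ∈ signedSelmerInfty W κ ε), D.toDual (j' χ) ⟨s, hs⟩ = χ (W.resOfLe p hle s)) :
    j = j' := by
  refine AddMonoidHom.ext fun χ ↦ D.bijective.injective (AddMonoidHom.ext fun s ↦ ?_)
  rw [hj χ s s.2, hj' χ s s.2]

/-! ## §3 What `range j` kills and what kills `j` -/

/-- **`range j` kills `Sel^ε ∩ ker res_H`**: `D.toDual (j χ) s = χ (res_H s) = χ 0 = 0` — the EASY inclusion of (LocCover).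
[cite: Kobayashi2003, (8.23) (p. 18)] -/
theorem toDual_charModelJ_eq_zero_of_resOfLe_eq_zero (D : SignedSelmerDualData W κ γ ε)
    (j : (W.subgroupH1 p H →+ AddCircle (1 : ℚ)) →+ D.X)
    (hj : ∀ (χ : W.subgroupH1 p H →+ AddCircle (1 : ℚ)) (s : W.subgroupH1 p κ.kerSubgroup)
      (hs : s ∈ signedSelmerInfty W κ ε), D.toDual (j χ) ⟨s, hs⟩ = χ (W.resOfLe p hle s))
    (χ : W.subgroupH1 p H →+ AddCircle (1 : ℚ)) {s : W.subgroupH1 p κ.kerSubgroup} (hs : s ∈ signedSelmerInfty W κ ε)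
    (hres : W.resOfLe p hle s = 0) : D.toDual (j χ) ⟨s, hs⟩ = 0 := by
  rw [hj χ s hs, hres, map_zero]

/-- **`ker j` is the annihilator of `res_H(Sel^ε_∞)`**: `j χ = 0 ↔ χ` kills `res_H(Sel^ε_∞) ≤ H¹(H, E[p^∞])`. (This is
where the local theory enters: by local duality the annihilator of the signed local condition is `H¹_ε ≅ ker Col^ε`.)
[cite: Kobayashi2003, Thm. 1.2 (proof) and Prop. 8.18 / (8.23) (p. 18)] -/
theorem charModelJ_eq_zero_iff (D : SignedSelmerDualData W κ γ ε) (j : (W.subgroupH1 p H →+ AddCircle (1 : ℚ)) →+ D.X)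
    (hj : ∀ (χ : W.subgroupH1 p H →+ AddCircle (1 : ℚ)) (s : W.subgroupH1 p κ.kerSubgroup)
      (hs : s ∈ signedSelmerInfty W κ ε), D.toDual (j χ) ⟨s, hs⟩ = χ (W.resOfLe p hle s))
    (χ : W.subgroupH1 p H →+ AddCircle (1 : ℚ)) :
    j χ = 0 ↔ ∀ (s : W.subgroupH1 p κ.kerSubgroup), s ∈ signedSelmerInfty W κ ε → χ (W.resOfLe p hle s) = 0 := by
  constructor
  · intro h s hs
    rw [← hj χ s hs, h, map_zero, AddMonoidHom.zero_apply]
  · intro h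
    refine D.bijective.injective (AddMonoidHom.ext fun s ↦ ?_)
    rw [hj χ s s.2, h s s.2, map_zero, AddMonoidHom.zero_apply]

/-! ## §4 The EXACT local cover -/

/-- **(LocCover) holds EXACTLY in the character model (`m = 0`).** If `D.toDual x` kills `Sel^ε_∞ ∩ ker res_H`, then
`x = j χ` for some character `χ` of `H¹(H, E[p^∞])`: `D.toDual x` factors through `res_H|_{Sel^ε}` (§1, `ℚ/ℤ` divisible)
and `x = D.toDual⁻¹ (χ ∘ res_H) = j χ`. [cite: Kobayashi2003, Thm. 1.2 (proof) and (8.23) (p. 18)] [cite: GreenbergLNM1716, §2] -/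
theorem mem_range_charModelJ_of_forall (D : SignedSelmerDualData W κ γ ε) (j : (W.subgroupH1 p H →+ AddCircle (1 : ℚ)) →+ D.X)
    (hj : ∀ (χ : W.subgroupH1 p H →+ AddCircle (1 : ℚ)) (s : W.subgroupH1 p κ.kerSubgroup)
      (hs : s ∈ signedSelmerInfty W κ ε), D.toDual (j χ) ⟨s, hs⟩ = χ (W.resOfLe p hle s))
    (x : D.X) (hx : ∀ (s : W.subgroupH1 p κ.kerSubgroup) (hs : s ∈ signedSelmerInfty W κ ε),
      W.resOfLe p hle s = 0 → D.toDual x ⟨s, hs⟩ = 0) :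
    x ∈ j.range := by
  obtain ⟨χ, hχ⟩ := exists_character_comp_eq_of_ker_le
    ((W.resOfLe p hle).comp (signedSelmerInfty W κ ε).subtype) (D.toDual x) (fun t ht ↦ hx t t.2 ht)
  refine ⟨χ, D.bijective.injective (AddMonoidHom.ext fun t ↦ ?_)⟩
  rw [hj χ t t.2, ← hχ]
  rfl

/-- **(LocCover), iff form**: `x ∈ range j ↔ D.toDual x` kills `Sel^ε_∞ ∩ ker res_H` — i.e. `range j = Ann(Sel^ε ∩ ker res_H)`,
the Pontryagin dual of `Sel^ε_∞ / (Sel^ε_∞ ∩ ker res_H) ≅ res_H(Sel^ε_∞)`. [cite: Kobayashi2003, (8.23) (p. 18)]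
[cite: GreenbergLNM1716, §2] -/
theorem mem_range_charModelJ_iff (D : SignedSelmerDualData W κ γ ε) (j : (W.subgroupH1 p H →+ AddCircle (1 : ℚ)) →+ D.X)
    (hj : ∀ (χ : W.subgroupH1 p H →+ AddCircle (1 : ℚ)) (s : W.subgroupH1 p κ.kerSubgroup)
      (hs : s ∈ signedSelmerInfty W κ ε), D.toDual (j χ) ⟨s, hs⟩ = χ (W.resOfLe p hle s))
    (x : D.X) :
    x ∈ j.range ↔ ∀ (s : W.subgroupH1 p κ.kerSubgroup) (hs : s ∈ signedSelmerInfty W κ ε),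
      W.resOfLe p hle s = 0 → D.toDual x ⟨s, hs⟩ = 0 := by
  refine ⟨?_, mem_range_charModelJ_of_forall W p κ ε hle D j hj x⟩
  rintro ⟨χ, rfl⟩ s hs hres
  exact toDual_charModelJ_eq_zero_of_resOfLe_eq_zero W p κ ε hle D j hj χ hs hres

/-! ## §5 The `Λ`-action through `j` -/

/-- **`T` through `j`, generator form**: `D.toDual (T • j χ) s = χ (res_H (conj_γ s)) − χ (res_H s)` (`T ↔ conj_γ − 1`,
`D.toDual_T_smul`). [cite: GreenbergLNM1716, §1] [cite: Kobayashi2003, Thm. 1.2 (the object) (p. 2)] -/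
theorem toDual_X_smul_charModelJ (D : SignedSelmerDualData W κ γ ε) (j : (W.subgroupH1 p H →+ AddCircle (1 : ℚ)) →+ D.X)
    (hj : ∀ (χ : W.subgroupH1 p H →+ AddCircle (1 : ℚ)) (s : W.subgroupH1 p κ.kerSubgroup)
      (hs : s ∈ signedSelmerInfty W κ ε), D.toDual (j χ) ⟨s, hs⟩ = χ (W.resOfLe p hle s))
    (χ : W.subgroupH1 p H →+ AddCircle (1 : ℚ)) (s : W.subgroupH1 p κ.kerSubgroup) (hs : s ∈ signedSelmerInfty W κ ε) :
    D.toDual ((PowerSeries.X : IwasawaAlgebra p) • j χ) ⟨s, hs⟩ =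
      χ (W.resOfLe p hle (W.conjH1 p κ.kerSubgroup γ s)) - χ (W.resOfLe p hle s) := by
  rw [D.toDual_T_smul, hj χ _ (D.conj_mem s hs), hj χ s hs]

/-- **`T` through `j`, closed form for NORMAL `H`**: `T • j χ = j (χ ∘ conj_γ|_{H¹(H)}) − j χ` — restriction commutes with
conjugation (`resOfLe_comp_conjH1_holds`). [cite: GreenbergLNM1716, §1] [cite: NeukirchSchmidtWingberg2008, I.§5] -/
theorem X_smul_charModelJ [H.Normal] (D : SignedSelmerDualData W κ γ ε) (j : (W.subgroupH1 p H →+ AddCircle (1 : ℚ)) →+ D.X)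
    (hj : ∀ (χ : W.subgroupH1 p H →+ AddCircle (1 : ℚ)) (s : W.subgroupH1 p κ.kerSubgroup)
      (hs : s ∈ signedSelmerInfty W κ ε), D.toDual (j χ) ⟨s, hs⟩ = χ (W.resOfLe p hle s))
    (χ : W.subgroupH1 p H →+ AddCircle (1 : ℚ)) :
    (PowerSeries.X : IwasawaAlgebra p) • j χ = j (χ.comp (W.conjH1 p H γ)) - j χ := by
  refine D.bijective.injective (AddMonoidHom.ext fun s ↦ ?_)
  rw [map_sub, AddMonoidHom.sub_apply, toDual_X_smul_charModelJ W p κ ε hle D j hj χ s s.2, hj _ s s.2, hj χ s s.2,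
    AddMonoidHom.comp_apply]
  have hc : (W.resOfLe p hle) (W.conjH1 p κ.kerSubgroup γ s) = (W.conjH1 p H γ) (W.resOfLe p hle s) := by
    change ((W.resOfLe p hle).comp (W.conjH1 p κ.kerSubgroup γ)) (s : W.subgroupH1 p κ.kerSubgroup) =
      ((W.conjH1 p H γ).comp (W.resOfLe p hle)) (s : W.subgroupH1 p κ.kerSubgroup)
    rw [resOfLe_comp_conjH1_holds]
  rw [hc]

/-- **Constants through `j`**: on a `p^k`-torsion class, `D.toDual (C c • j χ) s = (c mod p^k) • χ (res_H s)` (`D.toDual_C_smul`).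
[cite: GreenbergLNM1716, §1] [cite: Kobayashi2003, Thm. 1.2 (the object) (p. 2)] -/
theorem toDual_C_smul_charModelJ (D : SignedSelmerDualData W κ γ ε) (j : (W.subgroupH1 p H →+ AddCircle (1 : ℚ)) →+ D.X)
    (hj : ∀ (χ : W.subgroupH1 p H →+ AddCircle (1 : ℚ)) (s : W.subgroupH1 p κ.kerSubgroup)
      (hs : s ∈ signedSelmerInfty W κ ε), D.toDual (j χ) ⟨s, hs⟩ = χ (W.resOfLe p hle s))
    (c : ℤ_[p]) (χ : W.subgroupH1 p H →+ AddCircle (1 : ℚ)) (s : W.subgroupH1 p κ.kerSubgroup)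
    (hs : s ∈ signedSelmerInfty W κ ε) (k : ℕ) (hk : (p ^ k) • s = 0) :
    D.toDual ((PowerSeries.C c : IwasawaAlgebra p) • j χ) ⟨s, hs⟩ = (PadicInt.toZModPow k c).val • χ (W.resOfLe p hle s) := by
  have hk' : (p ^ k) • (⟨s, hs⟩ : signedSelmerInfty W κ ε) = 0 := Subtype.ext hk
  rw [D.toDual_C_smul c (j χ) ⟨s, hs⟩ k hk', hj χ s hs]

end CharModel

/-! ## §6 `K = ℚ`, `p = 2`, `H = ker κ ⊓ D_v`: the (LocCover) clause of K3's package, exactly -/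

section Two

variable (W : WeierstrassCurve ℚ) (κ : ZpExtension ℚ 2) {γ : absoluteGaloisGroup ℚ} (ε : ℤˣ)

/-- **The character-model `j` at `p = 2` with EXACT local cover**, for ANY `W/ℚ`, ANY `ℤ₂`-extension `κ`, any `γ`, any sign,
any finite place `v` and any pinned `D` (no reduction / minimality / supersingularity hypothesis is used): there is
`j : Hom(H¹(ker κ ⊓ D_v, E[2^∞]), ℚ/ℤ) →+ D.X` with
(value) `D.toDual (j χ) s = χ (res s)`;
(LocCover, `m = 0`) every `x` with `D.toDual x` killing `Sel^ε_∞ ∩ ker res` — verbatim the hypothesis of the local cover in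
`signedKatoDivisibilityUpToAtTwo_of_localRobustZetaSpanPackageTwo_rat_of_pub` — lies in `range j`;
(`T`-action) `D.toDual (T • j χ) s = χ (res (conj_γ s)) − χ (res s)`.
[cite: Kobayashi2003, Thm. 1.2 (proof) and (8.23) (p. 18)] [cite: GreenbergLNM1716, §1–2] -/
theorem exists_charModelJ_package_two (v : HeightOneSpectrum (𝓞 ℚ)) (D : SignedSelmerDualData W κ γ ε) :
    ∃ j : (W.subgroupH1 2 (κ.kerSubgroup ⊓ decomp v) →+ AddCircle (1 : ℚ)) →+ D.X,
      (∀ (χ : W.subgroupH1 2 (κ.kerSubgroup ⊓ decomp v) →+ AddCircle (1 : ℚ)) (s : W.subgroupH1 2 κ.kerSubgroup)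
        (hs : s ∈ signedSelmerInfty W κ ε),
        D.toDual (j χ) ⟨s, hs⟩ =
          χ (resOfLe (W.geomPrimaryTorsion 2) (inf_le_left : κ.kerSubgroup ⊓ decomp v ≤ κ.kerSubgroup) s)) ∧
      (∀ x : D.X,
        (∀ t : signedSelmerInfty W κ ε,
          resOfLe (W.geomPrimaryTorsion 2) (inf_le_left : κ.kerSubgroup ⊓ decomp v ≤ κ.kerSubgroup)
            (t : W.subgroupH1 2 κ.kerSubgroup) = 0 → D.toDual x t = 0) →
        x ∈ j.range) ∧
      (∀ (χ : W.subgroupH1 2 (κ.kerSubgroup ⊓ decomp v) →+ AddCircle (1 : ℚ)) (s : W.subgroupH1 2 κ.kerSubgroup)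
        (hs : s ∈ signedSelmerInfty W κ ε),
        D.toDual ((PowerSeries.X : IwasawaAlgebra 2) • j χ) ⟨s, hs⟩ =
          χ (resOfLe (W.geomPrimaryTorsion 2) (inf_le_left : κ.kerSubgroup ⊓ decomp v ≤ κ.kerSubgroup)
              (W.conjH1 2 κ.kerSubgroup γ s)) -
            χ (resOfLe (W.geomPrimaryTorsion 2) (inf_le_left : κ.kerSubgroup ⊓ decomp v ≤ κ.kerSubgroup) s)) := by
  obtain ⟨j, hj⟩ := exists_charModelJ W 2 κ ε (inf_le_left : κ.kerSubgroup ⊓ decomp v ≤ κ.kerSubgroup) D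
  refine ⟨j, hj, fun x hx ↦ ?_, fun χ s hs ↦ toDual_X_smul_charModelJ W 2 κ ε _ D j hj χ s hs⟩
  exact mem_range_charModelJ_of_forall W 2 κ ε _ D j hj x (fun s hs hres ↦ hx ⟨s, hs⟩ hres)

end Two

end SignedKatoOffTwo.LocalChar

end Summit.BirchSwinnertonDyer.BirchSwinnertonDyer.Theorems

end
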